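import Summits.CriticalPhenomena.Ising3D.ExclusionSentencesControl2DTrgGammaEps6

/-!
# Exclusion sentences — 2D control `Δ_ε = 1` vs the FULL `TRG` table at `10⁻⁶`, part 2 of 2
(cell `pub-ising3x`, seat recog-1, gen 6)

HONEST FRAMING: lottery ticket; floor = tightest certified 3D Ising CFT bounds; no exact-solution
claim without a proof.

Parts `4–7`, the assembled sentence `trgFull_control_eps6` (exception list EMPTY) and the printed shape
`control_eps6_not_trgFull`: a real within `10⁻⁶` of `1` is no member of the whole FAMILIES-v1 family `TRG`
(`D ≤ 17`, `h ≤ 32`).  See part 1, `ExclusionSentencesControl2DTrgGammaEps6.lean`.  No 3D digit is used anywhere.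
-/

namespace Summit.CriticalPhenomena.Ising3D

/-- Part 4 (classes `Γ(¼)⁴`, `Γ(⅓)^{−3}`) of the full-TRG sentence on `[1 − 10⁻⁶, 1 + 10⁻⁶]`, empty list. -/
theorem trgFull_control_eps6_p4 :
    trgFullPart 17 32 4 (1 - 1 / 10 ^ 6) (1 + 1 / 10 ^ 6) [] = true := by
  decide +kernel

/-- Part 5 (classes `Γ(⅓)^{−2}`, `Γ(⅓)^{−1}`). -/
theorem trgFull_control_eps6_p5 :
    trgFullPart 17 32 5 (1 - 1 / 10 ^ 6) (1 + 1 / 10 ^ 6) [] = true := by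
  decide +kernel

/-- Part 6 (classes `Γ(⅓)¹`, `Γ(⅓)²`). -/
theorem trgFull_control_eps6_p6 :
    trgFullPart 17 32 6 (1 - 1 / 10 ^ 6) (1 + 1 / 10 ^ 6) [] = true := by
  decide +kernel

/-- Part 7 (class `Γ(⅓)³`). -/
theorem trgFull_control_eps6_p7 :
    trgFullPart 17 32 7 (1 - 1 / 10 ^ 6) (1 + 1 / 10 ^ 6) [] = true := by
  decide +kernel

/-- **Full-TRG sentence at the 2D control `Δ_ε`, one rung later**: within `10⁻⁶` of `1` the whole FAMILIES-v1
family `TRG` (`D ≤ 17`, `h ≤ 32`) has NO member (empty exception list). -/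
theorem trgFull_control_eps6 :
    trgFullExcluded 17 32 (1 - 1 / 10 ^ 6) (1 + 1 / 10 ^ 6) [] = true :=
  trgFullExcluded_of_parts trgFull_control_eps6_p0 trgFull_control_eps6_p1 trgFull_control_eps6_p2
    trgFull_control_eps6_p3 trgFull_control_eps6_p4 trgFull_control_eps6_p5 trgFull_control_eps6_p6
    trgFull_control_eps6_p7

/-- Printed shape: a real within `10⁻⁶` of `1` is no member of the whole TRG table (`D ≤ 17`, `h ≤ 32`). -/
theorem control_eps6_not_trgFull {x : ℝ}
    (hx : ((1 - 1 / 10 ^ 6 : ℚ) : ℝ) ≤ x ∧ x ≤ ((1 + 1 / 10 ^ 6 : ℚ) : ℝ)) : x ∉ trgFullFamily 17 32 := by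
  intro hm
  obtain ⟨e, he, _⟩ := trgFullExcluded_sound trgFull_control_eps6 hx hm
  simp at he

/-- … in particular no member of the `Γ`-free table `trgFamily 17 32` (all five `L`). -/
theorem control_eps6_not_trg {x : ℝ}
    (hx : ((1 - 1 / 10 ^ 6 : ℚ) : ℝ) ≤ x ∧ x ≤ ((1 + 1 / 10 ^ 6 : ℚ) : ℝ)) : x ∉ trgFamily 17 32 :=
  fun hm => control_eps6_not_trgFull hx (trgFamily_subset_trgFullFamily 17 32 hm)

end Summit.CriticalPhenomena.Ising3D
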